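import Summits.BirchSwinnertonDyer.BirchSwinnertonDyer.Theses.UniversalToricDescent
import Summits.BirchSwinnertonDyer.BirchSwinnertonDyer.Theorems.UniversalToricDescentToricTransportModThreeStubRatSqueeze
import Summits.BirchSwinnertonDyer.BirchSwinnertonDyer.Theorems.UniversalToricDescentTorsionMuTransportHeegner
import Summits.BirchSwinnertonDyer.BirchSwinnertonDyer.Theorems.UniversalToricDescentRationalSplitIMCInclusionAtThreeOfWall
import HarnessLib

/-!
# NODE `ratwall_twin_transport` — crux `AdditiveSplitIMCInclusionAtThree` (stmt-BirchSwinnertonDyer-20395, THE WALL, UTD r201)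
# crux-ideate STANDING COVER round 6 (unit cruxidea-stmt-BirchSwinnertonDyer-20395-1-g6), 2026-08-30

D-0171 NODE (EQUIV/bookkeeping type; it HAS children). Purpose: make kernel-visible exactly what THE WALL demands
beyond the route's RATIONAL road, so that the director's «COVER CLOSED?» decision for this crux rests on a checked
statement and not on prose (LEAD-BRIEF-g6 §4(d): "the integral wall buys only the removal of 24737").

* `AdditiveSplitIMCInclusionAtThree_of` (kernel-checked, no `sorry`):
  WALL ⟸ RATWALL (`RationalSplitIMCInclusionAtThree`, item 24207, BY NAME — tag WEAKER: the landed
  `rationalSplitIMCInclusionAtThree_of_wall` gives WALL ⟹ RATWALL) + `TwinTorsionMuZeroSupplyAtThree` (NEW Prop,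
  POINTWISE IN `K`: at every wall context `(E, K, κ, 𝔭′, γ)` some `E′ ≡ E (mod 3)` whose conductor is Heegner for the
  SAME `K` has `X_(∅,0)(E′/K_∞)` `Λ`-torsion with `Ch·R₀⟦T⟧ = (g′)`, `g′` with a norm-one coefficient — tag UNDECIDED;
  it is the ONLY surplus of the wall over the rational wall). Proof = the landed mod-3 transport
  `torsionMuTransportModThree` (Theorems, p-1 g6; needs no `ClassO6`/surjectivity/odd-discriminant) + 3-saturation in
  the domain `R₀⟦T⟧` (landed `dvd_of_dvd_prime_pow_mul`, `prime_C_three`, `not_C_three_dvd_of_norm_coeff_eq_one`).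
* `twinTorsionMuZeroAt_of_twinAlgMu` (kernel-checked): on the locus where `closes` actually instantiates the wall —
  `Odd (discr K)` and a bucket twin `E′` (multiplicative très ramifié, or good supersingular with `a₃ = 0`) with
  `ρ̄_{E′,3}` onto whose conductor `N′` is Heegner for `K` — the pointwise datum IS item 24737 `TwinAlgMuZeroAtThree`
  BY NAME. Hence `onTwinLocus_of_ratwall_twinAlgMu`: THE WALL ON THAT LOCUS ⟸ 24207 ∧ 24737, both items of the
  rational road (kernel-checked composition; the locus statement `AdditiveSplitIMCInclusionAtThreeOnTwinLocus` is the
  wall's text VERBATIM with the twin binders of `TwinAlgMuZeroAtThree` inserted).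
* What is NOT implied (the wall's surplus, never consumed by `closes`, whose kernel items choose `K` odd and Heegner
  for BOTH conductors — `…KernelDegreeOnlyTwinOfPrint.bsdp_three_of_degreePackage_of_print`, hypotheses `hodd`, `hHN'`):
  (S1) `K` of EVEN discriminant; (S2) `K` Heegner for `N(E)` but for the conductor of NO congruent `μ = 0` twin.
  These are the leaves `stub_twinSupply` is honest about (see the line card `Lines/ratwall_twin_transport.md`).

`sorry` occurs ONLY in the two `stub_*` declarations (the open leaves, = items 24207 and the supply). Nothing here is a
theorem about elliptic curves beyond compositions of landed results; BSD is not advanced by this file.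
References: [GreenbergVatsal2000] §2 (invariants under congruence); [Howard2004HeegnerKolyvagin] Thm. 2.2.10 (shape of
the (∅,0) statement); [Washington1997] §7.1, §13.2 (`μ`, distinguished polynomials); Brink (tree leaf 20465/20466).
-/

set_option linter.dupNamespace false
set_option autoImplicit false

noncomputable section

open Literature.NumberTheory.EllipticCurves
open Summit.BirchSwinnertonDyer.BirchSwinnertonDyer.Theses.UniversalToricDescent
  (RationalSplitIMCInclusionAtThree AdditiveSplitIMCInclusionAtThree TwinAlgMuZeroAtThree)
open Summit.BirchSwinnertonDyer.BirchSwinnertonDyer.Cruxes.ToricTransportModThree.RatwallThinComb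
  (dvd_of_dvd_prime_pow_mul prime_C_three not_C_three_dvd_of_norm_coeff_eq_one)
open Summit.BirchSwinnertonDyer.BirchSwinnertonDyer.Theorems.UniversalToricDescentTorsionMuTransportHeegner
  (torsionMuTransportModThree)
open Summit.BirchSwinnertonDyer.BirchSwinnertonDyer.Theorems.UniversalToricDescentRationalSplitIMCInclusionAtThreeOfWall
  (rationalSplitIMCInclusionAtThree_of_wall)

namespace Summit.BirchSwinnertonDyer.BirchSwinnertonDyer.Cruxes.AdditiveSplitIMCInclusionAtThree.RatwallTwinTransport

/-! ## The pointwise twin datum and the supply (Props) -/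

/-- POINTWISE TWIN `μ = 0` DATUM at a wall context `(E = W, K, κ, 𝔭′, γ)`: some elliptic `W′/ℚ` with
`W′[3] ≅ W[3]` (`ModPCongruent W′ W 3`), conductor `N′` satisfying the Heegner hypothesis for the SAME `K`, such that
`X_(∅,0)(W′/K_∞)` (strict at `𝔭′`) is `Λ`-torsion and `Ch_Λ·R₀⟦T⟧ = (g′)` with a coefficient of `3`-adic norm `1`
(algebraic `μ = 0`) — exactly the input shape of the landed `torsionMuTransportModThree`. [GreenbergVatsal2000 §2] -/
def TwinTorsionMuZeroAt (W : WeierstrassCurve ℚ) [W.IsElliptic] (K : Type) [Field K] [NumberField K]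
    (κ : ZpExtension K 3) (𝔭' : IsDedekindDomain.HeightOneSpectrum (NumberField.RingOfIntegers K))
    (γ : Field.absoluteGaloisGroup K) [Fact (κ.IsTopGenerator γ)] : Prop :=
  ∃ (W' : WeierstrassCurve ℚ) (_ : W'.IsElliptic) (N' : ℕ),
    Summit.BirchSwinnertonDyer.Rank1Residual.O6.ModPCongruent W' W 3 ∧ W'.conductorNorm ℤ = N' ∧
    SatisfiesHeegnerHypothesis N' K ∧
    Module.IsTorsion (IwasawaAlgebra 3)
      (Summit.BirchSwinnertonDyer.Rank1Residual.X11b.AcSelmer.XAc (W'.baseChange K) 3 κ 𝔭' ∅ γ) ∧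
    ∃ g' : UnrSeries 3,
      (Summit.BirchSwinnertonDyer.Rank1Residual.X11b.AcSelmer.XAc.charIdeal (W'.baseChange K) 3 κ 𝔭' ∅ γ).map
          (PowerSeries.map (Summit.BirchSwinnertonDyer.Rank1Residual.X11b.Halves.toUnr 3)) = Ideal.span {g'} ∧
      ∃ i : ℕ, ‖((PowerSeries.coeff i g' : unrIntegers 3) : ℂ_[3])‖ = 1

/-- THE SUPPLY (UNDECIDED leaf; the wall's only surplus over the rational wall): at EVERY wall context — `E/ℚ` wild
additive at 3 (`ClassO6`), `ρ̄_{E,3}` onto, `r_an = 1`, conductor `N`, `K` imaginary quadratic Heegner for `N`, `κ`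
anticyclotomic with top generator `γ`, `𝔭 ∋ 3` of degree one, `𝔭′ ∋ 3`, `𝔭′ ≠ 𝔭` — the pointwise twin datum
`TwinTorsionMuZeroAt W K κ 𝔭′ γ` holds. On the ODD-discriminant / bucket-twin locus it is item 24737 by name
(`twinTorsionMuZeroAt_of_twinAlgMu`); off that locus (even `d_K`; `K` Heegner for no `μ = 0` twin level) nothing is
in print and `closes` never asks. [GreenbergVatsal2000 §2; BurungaleCastellaSkinner2025 Thm. 4.2.1(b)] -/
def TwinTorsionMuZeroSupplyAtThree : Prop :=
  ∀ (W : WeierstrassCurve ℚ) [W.IsElliptic] [W.IsGloballyMinimal] (N : ℕ) [NeZero N] (K : Type) [Field K]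
    [NumberField K], Summit.BirchSwinnertonDyer.Rank1Residual.Additive.ClassO6 W 3 → W.HasSurjectiveModNGaloisRep 3 →
    W.analyticRank = 1 → W.conductorNorm ℤ = N → IsImaginaryQuadratic K → SatisfiesHeegnerHypothesis N K →
    ∀ (κ : ZpExtension K 3), κ.IsAnticyclotomic →
    ∀ (γ : Field.absoluteGaloisGroup K) [Fact (κ.IsTopGenerator γ)]
      (𝔭 : IsDedekindDomain.HeightOneSpectrum (NumberField.RingOfIntegers K)),
      ((3 : ℕ) : NumberField.RingOfIntegers K) ∈ 𝔭.asIdeal →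
      𝔭.asIdeal.ramificationIdx (NumberField.RingOfIntegers ℚ) = 1 →
      𝔭.asIdeal.inertiaDeg (NumberField.RingOfIntegers ℚ) = 1 →
      ∀ (𝔭' : IsDedekindDomain.HeightOneSpectrum (NumberField.RingOfIntegers K)),
        ((3 : ℕ) : NumberField.RingOfIntegers K) ∈ 𝔭'.asIdeal → 𝔭' ≠ 𝔭 →
        TwinTorsionMuZeroAt W K κ 𝔭' γ

/-- THE WALL ON THE TWIN LOCUS: the text of `AdditiveSplitIMCInclusionAtThree` VERBATIM, with the twin binders of
item 24737 `TwinAlgMuZeroAtThree` inserted (a bucket twin `W′` — multiplicative très ramifié or good supersingular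
with `a₃ = 0` —, `ρ̄_{W′,3}` onto, conductor `N′` Heegner for the SAME `K`, `d_K` odd). This is the locus at which the
route's kernel items instantiate the wall (`K` chosen odd and Heegner for both conductors). -/
def AdditiveSplitIMCInclusionAtThreeOnTwinLocus : Prop :=
  ∀ (W : WeierstrassCurve ℚ) [W.IsElliptic] [W.IsGloballyMinimal] (N : ℕ) [NeZero N] (K : Type) [Field K]
    [NumberField K] (Dt : Literature.NumberTheory.EllipticCurves.ModularForms.ModularParametrizationData W N),
    Summit.BirchSwinnertonDyer.Rank1Residual.Additive.ClassO6 W 3 → W.HasSurjectiveModNGaloisRep 3 →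
    W.analyticRank = 1 → W.conductorNorm ℤ = N → IsImaginaryQuadratic K → SatisfiesHeegnerHypothesis N K →
    ∀ (W' : WeierstrassCurve ℚ) [W'.IsElliptic] [W'.IsGloballyMinimal] (N' : ℕ) [NeZero N']
      (Dt' : Literature.NumberTheory.EllipticCurves.ModularForms.ModularParametrizationData W' N'),
      Summit.BirchSwinnertonDyer.Rank1Residual.O6.ModPCongruent W' W 3 →
      (Literature.NumberTheory.EllipticCurves.Rank1Residual.Mult W' 3 ∧ ¬ 3 ∣ padicValInt 3 W'.minimalDiscriminantInt ∨
        Literature.NumberTheory.EllipticCurves.Rank1Residual.GoodSS W' 3 ∧ W'.frobeniusTrace 3 = 0) →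
      W'.HasSurjectiveModNGaloisRep 3 → W'.conductorNorm ℤ = N' → SatisfiesHeegnerHypothesis N' K →
      Odd (NumberField.discr K) →
    ∀ (κ : ZpExtension K 3), κ.IsAnticyclotomic →
    ∀ (γ : Field.absoluteGaloisGroup K) [Fact (κ.IsTopGenerator γ)]
      (𝔭 : IsDedekindDomain.HeightOneSpectrum (NumberField.RingOfIntegers K)),
      ((3 : ℕ) : NumberField.RingOfIntegers K) ∈ 𝔭.asIdeal →
      𝔭.asIdeal.ramificationIdx (NumberField.RingOfIntegers ℚ) = 1 →
      𝔭.asIdeal.inertiaDeg (NumberField.RingOfIntegers ℚ) = 1 →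
      ∀ (𝔭' : IsDedekindDomain.HeightOneSpectrum (NumberField.RingOfIntegers K)),
        ((3 : ℕ) : NumberField.RingOfIntegers K) ∈ 𝔭'.asIdeal → 𝔭' ≠ 𝔭 →
        ∀ (ι' : PadicAlgCl 3 ≃+* ℂ),
          Summit.BirchSwinnertonDyer.BirchSwinnertonDyer.Theorems.SchneiderFree.BranchInducesPrime 3 ι' 𝔭 →
          ∀ (ΩK : ℂ) (Ωp : ℂ_[3]) (L : UnrSeries 3), ΩK ≠ 0 → Ωp ≠ 0 →
            IsBDPLFunction ι' 𝔭 κ γ Dt.f ΩK Ωp L →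
            Ideal.span {L} ≤
              (Summit.BirchSwinnertonDyer.Rank1Residual.X11b.AcSelmer.XAc.charIdeal (W.baseChange K) 3 κ 𝔭' ∅ γ).map
                (PowerSeries.map (Summit.BirchSwinnertonDyer.Rank1Residual.X11b.Halves.toUnr 3))

/-! ## Registered leaves (the ONLY `sorry`s) -/

/-- LEAF 1 = route item 24207 `RationalSplitIMCInclusionAtThree` BY NAME (tag WEAKER than the crux: `ratwall_of_wall`
below; leaf ATTACKABLE — LEAD line `thin_comb` v8 / `ratwall_thin_comb`, items 32493 (K2-rat), K3a). -/
theorem stub_ratwall : RationalSplitIMCInclusionAtThree := by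
  sorry

/-- LEAF 2 = the pointwise twin supply (tag UNDECIDED; = item 24737 on the odd/bucket locus by
`twinTorsionMuZeroAt_of_twinAlgMu`; IDEA-NEEDED / BARRIER off it — see the line card). -/
theorem stub_twinSupply : TwinTorsionMuZeroSupplyAtThree := by
  sorry

/-! ## Evidence for the tags -/

/-- Tag WEAKER for leaf 1: the crux implies it (landed, `k = 0`). -/
theorem ratwall_of_wall : AdditiveSplitIMCInclusionAtThree → RationalSplitIMCInclusionAtThree :=
  rationalSplitIMCInclusionAtThree_of_wall

/-! ## TOP composition: RATWALL + pointwise twin `μ = 0` ⟹ THE WALL (concludes the crux BY NAME) -/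

/-- **The wall from the rational wall and the pointwise twin supply.** At a wall context, take the twin datum
`(W′, N′, g′)`; transport torsion and `μ = 0` from `W′` to `W` along `W′[3] ≅ W[3]` (`torsionMuTransportModThree`,
landed: needs only the two Heegner hypotheses for the same `K`); then `3^k·L ∈ (g)` with `3 ∤ g` in the domain
`R₀⟦T⟧` (`3` prime) forces `g ∣ L`, i.e. `(L) ⊆ (g) = Ch·R₀⟦T⟧`. [folklore; Washington1997 §7.1] -/
theorem AdditiveSplitIMCInclusionAtThree_of :
    RationalSplitIMCInclusionAtThree → TwinTorsionMuZeroSupplyAtThree → AdditiveSplitIMCInclusionAtThree := by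
  intro hR hS W _ _ N _ K _ _ Dt hO6 hsurj hr1 hN hK hH κ hκ γ _ 𝔭 h3 he hf 𝔭' h3' hne ι' hι ΩK Ωp L hΩK hΩp hL
  obtain ⟨k, hk⟩ := hR W N K Dt hO6 hsurj hr1 hN hK hH κ hκ γ 𝔭 h3 he hf 𝔭' h3' hne ι' hι ΩK Ωp L hΩK hΩp hL
  obtain ⟨W', _, N', hcong, hN', hH', hT', hg'⟩ := hS W N K hO6 hsurj hr1 hN hK hH κ hκ γ 𝔭 h3 he hf 𝔭' h3' hne
  obtain ⟨-, g, hg, i, hi⟩ := torsionMuTransportModThree W W' K hN hcong hN' hK hH hH' κ hκ γ 𝔭' h3' hT' hg'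
  rw [hg] at hk ⊢
  have hdvd : g ∣ ((3 : ℕ) : UnrSeries 3) ^ k * L := Ideal.mem_span_singleton.mp hk
  rw [← map_natCast (PowerSeries.C (R := unrIntegers 3))] at hdvd
  exact Ideal.span_singleton_le_span_singleton.mpr
    (dvd_of_dvd_prime_pow_mul prime_C_three (not_C_three_dvd_of_norm_coeff_eq_one hi) k hdvd)

/-! ## The locus: there the supply IS item 24737 -/

/-- **Pointwise datum from `TwinAlgMuZeroAtThree` (item 24737) BY NAME** on the odd/bucket-twin locus. -/
theorem twinTorsionMuZeroAt_of_twinAlgMu (hA : TwinAlgMuZeroAtThree)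
    (W : WeierstrassCurve ℚ) [W.IsElliptic] (W' : WeierstrassCurve ℚ) [W'.IsElliptic] [W'.IsGloballyMinimal]
    (N' : ℕ) [NeZero N'] (K : Type) [Field K] [NumberField K]
    (Dt' : Literature.NumberTheory.EllipticCurves.ModularForms.ModularParametrizationData W' N')
    (hcong : Summit.BirchSwinnertonDyer.Rank1Residual.O6.ModPCongruent W' W 3)
    (hbucket : Literature.NumberTheory.EllipticCurves.Rank1Residual.Mult W' 3 ∧
        ¬ 3 ∣ padicValInt 3 W'.minimalDiscriminantInt ∨
      Literature.NumberTheory.EllipticCurves.Rank1Residual.GoodSS W' 3 ∧ W'.frobeniusTrace 3 = 0)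
    (hsurj' : W'.HasSurjectiveModNGaloisRep 3) (hN' : W'.conductorNorm ℤ = N') (hK : IsImaginaryQuadratic K)
    (hH' : SatisfiesHeegnerHypothesis N' K) (hodd : Odd (NumberField.discr K))
    (κ : ZpExtension K 3) (hκ : κ.IsAnticyclotomic) (γ : Field.absoluteGaloisGroup K) [Fact (κ.IsTopGenerator γ)]
    (𝔭 : IsDedekindDomain.HeightOneSpectrum (NumberField.RingOfIntegers K))
    (h3 : ((3 : ℕ) : NumberField.RingOfIntegers K) ∈ 𝔭.asIdeal)
    (he : 𝔭.asIdeal.ramificationIdx (NumberField.RingOfIntegers ℚ) = 1)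
    (hf : 𝔭.asIdeal.inertiaDeg (NumberField.RingOfIntegers ℚ) = 1)
    (𝔭' : IsDedekindDomain.HeightOneSpectrum (NumberField.RingOfIntegers K))
    (h3' : ((3 : ℕ) : NumberField.RingOfIntegers K) ∈ 𝔭'.asIdeal) (hne : 𝔭' ≠ 𝔭) :
    TwinTorsionMuZeroAt W K κ 𝔭' γ := by
  obtain ⟨hT', hg'⟩ := hA W' N' K Dt' hbucket hsurj' hN' hK hH' hodd κ hκ γ 𝔭 h3 he hf 𝔭' h3' hne
  exact ⟨W', ‹W'.IsElliptic›, N', hcong, hN', hH', hT', hg'⟩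

/-- **THE WALL ON THE TWIN LOCUS ⟸ 24207 ∧ 24737** (both items of the RATIONAL road), kernel-checked: at a
context of the locus, the datum is 24737's conclusion, transported by `torsionMuTransportModThree`, and the
3-saturation of `AdditiveSplitIMCInclusionAtThree_of` finishes. This is LEAD-BRIEF-g6 §4(d) as a theorem: on the
locus the kernel uses, the integral wall costs nothing beyond the rational road. [folklore] -/
theorem onTwinLocus_of_ratwall_twinAlgMu :
    RationalSplitIMCInclusionAtThree → TwinAlgMuZeroAtThree → AdditiveSplitIMCInclusionAtThreeOnTwinLocus := by
  intro hR hA W _ _ N _ K _ _ Dt hO6 hsurj hr1 hN hK hH W' _ _ N' _ Dt' hcong hbucket hsurj' hN' hH' hodd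
    κ hκ γ _ 𝔭 h3 he hf 𝔭' h3' hne ι' hι ΩK Ωp L hΩK hΩp hL
  obtain ⟨k, hk⟩ := hR W N K Dt hO6 hsurj hr1 hN hK hH κ hκ γ 𝔭 h3 he hf 𝔭' h3' hne ι' hι ΩK Ωp L hΩK hΩp hL
  obtain ⟨hT', hg'⟩ := hA W' N' K Dt' hbucket hsurj' hN' hK hH' hodd κ hκ γ 𝔭 h3 he hf 𝔭' h3' hne
  obtain ⟨-, g, hg, i, hi⟩ := torsionMuTransportModThree W W' K hN hcong hN' hK hH hH' κ hκ γ 𝔭' h3' hT' hg'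
  rw [hg] at hk ⊢
  have hdvd : g ∣ ((3 : ℕ) : UnrSeries 3) ^ k * L := Ideal.mem_span_singleton.mp hk
  rw [← map_natCast (PowerSeries.C (R := unrIntegers 3))] at hdvd
  exact Ideal.span_singleton_le_span_singleton.mpr
    (dvd_of_dvd_prime_pow_mul prime_C_three (not_C_three_dvd_of_norm_coeff_eq_one hi) k hdvd)

/-- The crux restricted to the locus is (trivially) implied by the crux: the locus statement only ADDS binders. -/
theorem onTwinLocus_of_wall : AdditiveSplitIMCInclusionAtThree → AdditiveSplitIMCInclusionAtThreeOnTwinLocus := by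
  intro hW W _ _ N _ K _ _ Dt hO6 hsurj hr1 hN hK hH W' _ _ N' _ Dt' _ _ _ _ _ _
    κ hκ γ _ 𝔭 h3 he hf 𝔭' h3' hne ι' hι ΩK Ωp L hΩK hΩp hL
  exact hW W N K Dt hO6 hsurj hr1 hN hK hH κ hκ γ 𝔭 h3 he hf 𝔭' h3' hne ι' hι ΩK Ωp L hΩK hΩp hL

end Summit.BirchSwinnertonDyer.BirchSwinnertonDyer.Cruxes.AdditiveSplitIMCInclusionAtThree.RatwallTwinTransport

end
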